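import Literature.IUT.HodgeTheaters.GlobalFrobenioidsGaloisChart
import HarnessLib

/-!
# [IUTchI] Example 5.1 (i)–(iii) — NON-VACUITY WITNESS for `NFBridgeRecon.GaloisChart` (row «NV-L5/NFBridgeRecon.GaloisChart»)
# WITNESS/TOY MODULE, NOT A CONE MEMBER (def-bearing; filed after the 05:00Z DEFS-FREEZE census per L5 RULINGS #27 (b))

Mochizuki, *Inter-universal Teichmüller theory I*, kurims manuscript (May 2020), Example 5.1 (i) p. 123: "we may
construct group-theoretically from `π₁(†𝒟^⊚)` an isomorph of `F̄^×` — which we shall denote `𝕄^⊛(†𝒟^⊚)` —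
equipped with its natural `π₁(†𝒟^⊚)`-action … a profinite group corresponding to `C_{F_mod}` … together with a
natural extension of the action … to `π₁(†𝒟^⊛)`.  In particular, by taking `π₁(†𝒟^⊛)`-invariants, we obtain a
submonoid/subfield … corresponding to `F^×_mod ⊆ F̄^×`, `F_mod ⊆ F̄`."

abc-iut-w4-d050's adapter `GlobalFrobenioidsGaloisChart.lean` (p419342) types print's "isomorph of `F̄` … with
its natural `π₁(†𝒟^⊛)`-action" as the DATUM `NFBridgeRecon.GaloisChart N F` (a continuous surjection
`ρ : π₁(†𝒟^⊛) ↠ G_F` + an equivariant ring isomorphism `𝕄̄^⊛(†𝒟^⊚) ≅ F̄`) over abc-iut-L5-t1's interface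
`NFBridgeRecon` (`GlobalFrobenioids.lean`), and proves [IUTchI] Ex 5.1 (ii)/(iii) UNCONDITIONALLY over any chart.
The type `GaloisChart N F` had NO producer in the tree, so those nine theorems were uninstantiated.  THIS FILE
builds the producer:

* `NFBridgeRecon.ofGaloisQuotient F l ρ` — for ANY profinite `G` with a continuous SURJECTION
  `ρ : G ↠ G_F = Gal(F̄/F)` (print's `π₁(†𝒟^⊛) ↠ G_{F_mod}` is such a `ρ`), the `NFBridgeRecon` whose
  CONSTANT-FIELD side is GENUINE — `π₁(†𝒟^⊛) := G` acting on Mathlib's `F̄ = AlgebraicClosure F` through `ρ`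
  (smooth: stabilisers are `ρ`-preimages of Krull-open stabilisers) — and whose FUNCTION-FIELD side is
  DEGENERATE and labelled so (`π₁^rat := G`, `K_rat := F̄`, constants = everything, coric sets := `F̄ ∖ {0}`,
  `solKer := ⊤`, Aut-data trivial): the rational-function objects of (i) (`𝕄^⊛_κ ⊆ 𝕄^⊛_∞κ ⊆ 𝕄^⊛_∞κ×` inside the
  function field of `C_{F_mod}`, Rmk 3.1.7) are NOT modelled here;
* `NFBridgeRecon.GaloisChart.ofGaloisQuotient` — its chart `(ρ, RingEquiv.refl F̄)`; `NFBridgeRecon.galoisModel F l`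
  / `GaloisChart.ofGaloisModel` — the special case `G := G_F`, `ρ := id`;
* consequences (theorems): `Nonempty` of the chart type at these models; t1's REAL `MbarMod` of the model is
  EXACTLY the bottom field `F` (`mem_mbarMod_ofGaloisQuotient_iff` — Krull's `F̄^{G_F} = F` through w4-d050's
  `mem_mbarMod_iff`); and the nine chart theorems INSTANTIATED (`isFrobenioid_ofChart_ofGaloisModel`, …).

HONEST LABEL: model-relative — GENUINE Galois/constant-field side (this is the actual `G_{F_mod} ↷ F̄` of print,
and every genuine `π₁(†𝒟^⊛) ↠ G_{F_mod}` factors the witness `ofGaloisQuotient`), DEGENERATE function-field side.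
Witness/toy module: owes no «DEFINITION FROZEN» stamp, is never cited as a definition of the cone; nothing of
[IUTchI] is asserted; "instantiated ≠ endorsed". [claim: Mochizuki2012, status: disputed]
-/

noncomputable section

namespace Literature.IUT.HodgeTheaters

open Literature.AlgebraicGeometry.Frobenioids
open scoped IntermediateField

namespace NFBridgeRecon

section OfGaloisQuotient

variable (F : Type) [Field F] (l : ℕ) {G : ProfiniteGrp.{0}} (ρ : G →ₜ* QuasiTemperoid.GalFbar F)

/-- The `G`-action on `F̄` through `ρ : G → G_F` (an `F`-algebra automorphism acts by evaluation).
WITNESS-class auxiliary. [claim: Mochizuki2012, status: disputed] -/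
abbrev fbarActionAlong : MulSemiringAction G (QuasiTemperoid.Fbar F) :=
  MulSemiringAction.compHom (QuasiTemperoid.Fbar F) (ρ : G →* QuasiTemperoid.GalFbar F)

/-- Smoothness of the action through `ρ`: the stabiliser of `x ∈ F̄` in `G` is open — it is the `ρ`-preimage of the
stabiliser in `G_F`, which contains the Krull-open subgroup `Gal(F̄/F(x))` (`F(x)/F` finite).
[claim: Mochizuki2012, status: disputed] -/
theorem isOpen_stabilizer_along (x : QuasiTemperoid.Fbar F) :
    IsOpen (@MulAction.stabilizer G (QuasiTemperoid.Fbar F) _ (fbarActionAlong F ρ).toMulAction x : Set G) := by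
  letI := fbarActionAlong F ρ
  -- the stabiliser in `G_F` is open: it contains `Gal(F̄/F⟮x⟯)`
  have hx : IsIntegral F x := Algebra.IsIntegral.isIntegral x
  haveI : FiniteDimensional F F⟮x⟯ := IntermediateField.adjoin.finiteDimensional hx
  have hopen : IsOpen (MulAction.stabilizer (QuasiTemperoid.GalFbar F) x : Set (QuasiTemperoid.GalFbar F)) := by
    refine Subgroup.isOpen_mono ?_ (IntermediateField.fixingSubgroup_isOpen F⟮x⟯)
    intro σ hσ
    rw [MulAction.mem_stabilizer_iff]
    exact (IntermediateField.mem_fixingSubgroup_iff _ _).1 hσ x (IntermediateField.mem_adjoin_simple_self F x)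
  have hpre : (MulAction.stabilizer G x : Set G) = ρ ⁻¹' (MulAction.stabilizer (QuasiTemperoid.GalFbar F) x : Set (QuasiTemperoid.GalFbar F)) := by
    ext g
    simp only [SetLike.mem_coe, MulAction.mem_stabilizer_iff, Set.mem_preimage]
    rfl
  rw [hpre]
  exact hopen.preimage ρ.continuous

/-- **The witness `NFBridgeRecon` over a Galois quotient `ρ : G ↠ G_F`** — GENUINE constant-field side
(`π₁(†𝒟^⊛) := G ↷ F̄` through `ρ`; `π₁(†𝒟^⊚) := G` itself), DEGENERATE function-field side (`π₁^rat := G`,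
`K_rat := F̄` with constants = everything, all three coric sets := `F̄ ∖ {0}`, `solKer := ⊤`, Aut-data `PUnit`).
WITNESS-class (not a cone definition). ([IUTchI] Ex 5.1 (i) p.123) [claim: Mochizuki2012, status: disputed] -/
def ofGaloisQuotient : NFBridgeRecon.{0} where
  l := l
  piDast := G
  piDcirc := ⊤
  Fbar := QuasiTemperoid.Fbar F
  fbarField := inferInstance
  fbarAction := fbarActionAlong F ρ
  isOpen_stabilizer_fbar := isOpen_stabilizer_along F ρ
  piRat := G
  ratToAst := ContinuousMonoidHom.id G
  ratToAst_surjective := Function.surjective_id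
  Krat := QuasiTemperoid.Fbar F
  kratField := inferInstance
  kratAction := fbarActionAlong F ρ
  isOpen_stabilizer_krat := isOpen_stabilizer_along F ρ
  const := RingHom.id (QuasiTemperoid.Fbar F)
  const_smul := fun _ _ => rfl
  Mκ := {f | f ≠ 0}
  Minfκ := {f | f ≠ 0}
  Minfκx := {f | f ≠ 0}
  mκ_subset := subset_rfl
  minfκ_subset := subset_rfl
  zero_notMem := fun h => h rfl
  smul_mem_minfκ := fun g f hf => by
    letI := fbarActionAlong F ρ
    change (ρ g) f ≠ 0
    exact (map_ne_zero_iff (ρ g) (ρ g).injective).2 hf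
  smul_mem_minfκx := fun g f hf => by
    letI := fbarActionAlong F ρ
    change (ρ g) f ≠ 0
    exact (map_ne_zero_iff (ρ g) (ρ g).injective).2 hf
  solKer := ⊤
  solKer_normal := inferInstance
  AutD := PUnit
  autGroup := inferInstance
  Autε := ⊤
  AutSL := ⊤
  AutSLε := ⊤
  autSLε_le := le_rfl
  autSLε_le_autε := le_rfl
  lift := fun _ => ContinuousMulEquiv.refl G

/-- The witness' `π₁(†𝒟^⊛)` is `G`. [claim: Mochizuki2012, status: disputed] -/
theorem ofGaloisQuotient_piDast : (ofGaloisQuotient F l ρ).piDast = G := rfl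

/-- The witness' `𝕄̄^⊛(†𝒟^⊚)` is Mathlib's `F̄ = AlgebraicClosure F`. [claim: Mochizuki2012, status: disputed] -/
theorem ofGaloisQuotient_fbar : (ofGaloisQuotient F l ρ).Fbar = QuasiTemperoid.Fbar F := rfl

/-- DEGENERATE-side marker: the witness' "function field" `K_rat` is just `F̄` (no rational functions modelled).
[claim: Mochizuki2012, status: disputed] -/
theorem ofGaloisQuotient_krat : (ofGaloisQuotient F l ρ).Krat = QuasiTemperoid.Fbar F := rfl

/-- The action of `g ∈ G` on `x ∈ 𝕄̄^⊛ = F̄` is evaluation of the Galois automorphism `ρ g`.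
[claim: Mochizuki2012, status: disputed] -/
theorem ofGaloisQuotient_smul (g : (ofGaloisQuotient F l ρ).piDast) (x : (ofGaloisQuotient F l ρ).Fbar) :
    g • x = (ρ g : QuasiTemperoid.GalFbar F) (show QuasiTemperoid.Fbar F from x) := rfl

/-- **The Galois chart of the witness**: `(ρ, id_{F̄})` — print's "isomorph of `F̄` with its natural
`π₁(†𝒟^⊛)`-action" is here `F̄` itself. ([IUTchI] Ex 5.1 (i) p.123) [claim: Mochizuki2012, status: disputed] -/
def GaloisChart.ofGaloisQuotient [NumberField F] (hρ : Function.Surjective ρ) :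
    (ofGaloisQuotient F l ρ).GaloisChart F where
  ρ := ρ
  surjective := hρ
  iso := RingEquiv.refl _
  iso_smul := fun _ _ => rfl

/-- Hence the chart type over the witness is inhabited. [claim: Mochizuki2012, status: disputed] -/
theorem nonempty_galoisChart_ofGaloisQuotient [NumberField F] (hρ : Function.Surjective ρ) :
    Nonempty ((ofGaloisQuotient F l ρ).GaloisChart F) :=
  ⟨GaloisChart.ofGaloisQuotient F l ρ hρ⟩

/-- **[IUTchI] Ex 5.1 (i) "`𝕄̄^⊛_mod(†𝒟^⊚)` … corresponding to `F_mod ⊆ F̄`" AT THE WITNESS**: abc-iut-L5-t1's REAL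
`MbarMod` (the `π₁(†𝒟^⊛)`-invariants of `𝕄̄^⊛`) is EXACTLY the bottom field `F ⊆ F̄` — Krull's `F̄^{G_F} = F` pulled
back along the surjection `ρ` (w4-d050's `GaloisChart.mem_mbarMod_iff` at the chart `(ρ, id)`).
([IUTchI] Ex 5.1 (i) p.123) [claim: Mochizuki2012, status: disputed] -/
theorem mem_mbarMod_ofGaloisQuotient_iff [NumberField F] (hρ : Function.Surjective ρ) (x : QuasiTemperoid.Fbar F) :
    (show (ofGaloisQuotient F l ρ).Fbar from x) ∈ (ofGaloisQuotient F l ρ).MbarMod ↔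
      x ∈ (⊥ : IntermediateField F (QuasiTemperoid.Fbar F)) :=
  (GaloisChart.ofGaloisQuotient F l ρ hρ).mem_mbarMod_iff x

/-- … in particular every element of `F` (embedded in `F̄`) is a `π₁(†𝒟^⊛)`-invariant of the witness, and
conversely. ([IUTchI] Ex 5.1 (i) p.123) [claim: Mochizuki2012, status: disputed] -/
theorem algebraMap_mem_mbarMod_ofGaloisQuotient [NumberField F] (hρ : Function.Surjective ρ) (a : F) :
    (show (ofGaloisQuotient F l ρ).Fbar from algebraMap F (QuasiTemperoid.Fbar F) a) ∈ (ofGaloisQuotient F l ρ).MbarMod :=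
  (mem_mbarMod_ofGaloisQuotient_iff F l ρ hρ _).2 (IntermediateField.mem_bot.2 ⟨a, rfl⟩)

end OfGaloisQuotient

/-! ### The special case `G := G_F`, `ρ := id` -/

section GaloisModel

variable (F : Type) [Field F] [NumberField F] (l : ℕ)

/-- **The Galois model** `π₁(†𝒟^⊛) := G_F = Gal(F̄/F)` (Mathlib's absolute Galois group as the profinite group
`absGalGrp F`) acting tautologically on `F̄`; function-field side degenerate as in `ofGaloisQuotient`.
WITNESS-class. ([IUTchI] Ex 5.1 (i) p.123) [claim: Mochizuki2012, status: disputed] -/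
def galoisModel : NFBridgeRecon.{0} :=
  ofGaloisQuotient F l (ContinuousMonoidHom.id (absGalGrp F))

/-- Its chart `(id, id)`. ([IUTchI] Ex 5.1 (i) p.123) [claim: Mochizuki2012, status: disputed] -/
def GaloisChart.ofGaloisModel : (galoisModel F l).GaloisChart F :=
  GaloisChart.ofGaloisQuotient F l (ContinuousMonoidHom.id (absGalGrp F)) Function.surjective_id

/-- **NV-L5 row «NFBridgeRecon.GaloisChart»: WITNESSED** — the chart type is inhabited at the Galois model.
([IUTchI] Ex 5.1 (i) p.123) [claim: Mochizuki2012, status: disputed] -/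
theorem nonempty_galoisChart_galoisModel : Nonempty ((galoisModel F l).GaloisChart F) :=
  ⟨GaloisChart.ofGaloisModel F l⟩

/-- The type `NFBridgeRecon` itself thereby has a CLOSED-TERM inhabitant with genuine Galois side (complementing
the in-proof toy of `GlobalFrobenioidsCoricRigidityIndependence.lean`). [claim: Mochizuki2012, status: disputed] -/
theorem nonempty_nfBridgeRecon : Nonempty NFBridgeRecon.{0} := ⟨galoisModel ℚ 5⟩

/-- At the Galois model `𝕄̄^⊛_mod = F`: t1's invariants are exactly the bottom field (Krull).
([IUTchI] Ex 5.1 (i) p.123) [claim: Mochizuki2012, status: disputed] -/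
theorem mem_mbarMod_galoisModel_iff (x : QuasiTemperoid.Fbar F) :
    (show (galoisModel F l).Fbar from x) ∈ (galoisModel F l).MbarMod ↔ x ∈ (⊥ : IntermediateField F (QuasiTemperoid.Fbar F)) :=
  mem_mbarMod_ofGaloisQuotient_iff F l _ Function.surjective_id x

end GaloisModel

end NFBridgeRecon

/-! ### The nine chart theorems of `GlobalFrobenioidsGaloisChart.lean`, INSTANTIATED at the Galois model -/

section Instantiated

variable (F : Type) [Field F] [NumberField F] (l : ℕ)

open NFBridgeRecon

/-- [IUTchI] Ex 5.1 (ii) at the Galois model: all [FrdI] Thm 5.2 hypotheses hold for the chart's divisor data —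
INSTANTIATED (no variable left but the number field `F` and the label `l`). ([IUTchI] Ex 5.1 (ii) p.125)
[claim: Mochizuki2012, status: disputed] -/
theorem ofChart_hypotheses_ofGaloisModel :
    ModelFrobenioid.Hypotheses (GlobalDivisorData.ofChart (GaloisChart.ofGaloisModel F l)).Φ
      (GlobalDivisorData.ofChart (GaloisChart.ofGaloisModel F l)).B :=
  GlobalDivisorData.ofChart_hypotheses _

/-- [IUTchI] Ex 5.1 (ii) at the Galois model: "`ℱ^⊛(†𝒟^⊚)` is a [model] Frobenioid" — INSTANTIATED.
([IUTchI] Ex 5.1 (ii) p.125) [claim: Mochizuki2012, status: disputed] -/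
theorem isFrobenioid_ofChart_ofGaloisModel :
    PreFrobenioid.IsFrobenioid (ModelFrobenioid.toElem
      (GlobalDivisorData.ofChart (GaloisChart.ofGaloisModel F l)).Φ
      (GlobalDivisorData.ofChart (GaloisChart.ofGaloisModel F l)).B
      (GlobalDivisorData.ofChart (GaloisChart.ofGaloisModel F l)).div) :=
  GlobalDivisorData.isFrobenioid_ofChart _

/-- … of isotropic type — INSTANTIATED. ([IUTchI] Ex 5.1 (ii) p.125) [claim: Mochizuki2012, status: disputed] -/
theorem isOfIsotropicType_ofChart_ofGaloisModel :
    PreFrobenioid.IsOfIsotropicType (ModelFrobenioid.toElem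
      (GlobalDivisorData.ofChart (GaloisChart.ofGaloisModel F l)).Φ
      (GlobalDivisorData.ofChart (GaloisChart.ofGaloisModel F l)).B
      (GlobalDivisorData.ofChart (GaloisChart.ofGaloisModel F l)).div) :=
  GlobalDivisorData.isOfIsotropicType_ofChart _

/-- [IUTchI] Ex 5.1 (iv) at the Galois model: the rational-function monoid structure exists — INSTANTIATED.
([IUTchI] Ex 5.1 (iv) p.126) [claim: Mochizuki2012, status: disputed] -/
theorem nonempty_rationalFunctionMonoidStr_ofChart_ofGaloisModel :
    Nonempty (PreFrobenioid.RationalFunctionMonoidStr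
      (ModelFrobenioid.toElem (GlobalDivisorData.ofChart (GaloisChart.ofGaloisModel F l)).Φ
        (GlobalDivisorData.ofChart (GaloisChart.ofGaloisModel F l)).B
        (GlobalDivisorData.ofChart (GaloisChart.ofGaloisModel F l)).div)
      (GlobalDivisorData.isFrobenioid_ofChart _)
      (GlobalDivisorData.ofChart (GaloisChart.ofGaloisModel F l)).B
      (GlobalDivisorData.ofChart (GaloisChart.ofGaloisModel F l)).div) :=
  GlobalDivisorData.nonempty_rationalFunctionMonoidStr_ofChart _

/-- [IUTchI] Ex 5.1 (i): the open subgroup `π₁(†𝒟^⊚)` of the Galois model is compact (profinite) — INSTANTIATED,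
so `fcirc_isFrobenioid_ofChart` applies to `†𝒟^⊚ := ℬ(π₁(†𝒟^⊚))⁰` over the model.
([IUTchI] Ex 5.1 (i) p.123) [claim: Mochizuki2012, status: disputed] -/
theorem compactSpace_piDcirc_galoisModel : CompactSpace (galoisModel F l).piDcirc :=
  (galoisModel F l).compactSpace_piDcirc

end Instantiated

end Literature.IUT.HodgeTheaters

end
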